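import Mathlib

/-!
# NextRungP4g25 — non-routing (NR) books for the LRA rung: the linear-algebra core (scratch namespace; `dimFunding` PROVED, no sorry)

Crux `stmt-PneNP-18538` (`KrwChromaticSteering.StrongComposition`), line C1|LRA (`Lines/lra_gluing.lean`,
registered stub `stub_lraQuantitative`).  Memo `LensBarrierP4g25.md`.

In the NON-ROUTING books Alice's structural knowledge is ONE subspace `Σ ≤ K^{m×n}` of parity functionals
(`K = ZMod 2` in the game; any field here); every structure bit adds at most one dimension to `Σ`; nothing is
routed into per-row ledgers and nothing is stripped at a declaration.  Row `j`'s FORCED SECTIONS are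
`Σ ⊓ V_j` (functionals supported on row `j`), its LOAD is `dim π_j(Σ)`.

* `DimFunding` — the dimension funding inequality: for every row `j⋆`,
  `(∑_{j ≠ j⋆} dim (Σ ⊓ V_j)) + dim π_{j⋆}(Σ) ≤ dim Σ`.
  Books reading (memo §1): every killed row carries a nonzero forced section, distinct rows' sections are
  independent, and the deepest alive row's load is `dim Σ − dim (Σ ⊓ V_{¬j⋆})`; hence
  `#kills + max-depth ≤ #(dimension-adding non-declaring bits) + 1` — the label-inclusive funding
  inequality (R) of P4g24 §6 with constant 1, for every designer sequence, with no potential, bank or retirement.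
* `ElimProj` — elimination: the projection of the solution set of a consistent system onto row `j` is cut out
  exactly by the forced sections `Σ ⊓ V_j` (why SECTIONS, not loads, measure a row's class when completions off
  row `j` are free; memo §3 G1).
Both are statements (`Prop`s); `dimFunding` below proves the first.
-/

set_option linter.dupNamespace false

namespace Summit.PneNP.PneNP.Cruxes.StrongComposition.P4g25

open Module

variable (K : Type*) [Field K] (m n : ℕ)

/-- Matrices `m × n` over `K` as functions on index pairs (the ambient space of parity functionals AND of inputs). -/
abbrev Mat := Fin m × Fin n → K

/-- `V_i`: functionals supported on row `i`. -/
def rowSub (i : Fin m) : Submodule K (Mat K m n) where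
  carrier := {v | ∀ p : Fin m × Fin n, p.1 ≠ i → v p = 0}
  add_mem' := by
    intro a b ha hb p hp
    simp [Pi.add_apply, ha p hp, hb p hp]
  zero_mem' := by
    intro p hp; rfl
  smul_mem' := by
    intro c a ha p hp
    simp [Pi.smul_apply, ha p hp]

/-- `π_i`: restriction of a functional (or an input) to row `i`. -/
def rowProj (i : Fin m) : Mat K m n →ₗ[K] (Fin n → K) :=
  LinearMap.pi fun c : Fin n => (LinearMap.proj (i, c) : Mat K m n →ₗ[K] K)

variable {K m n}

@[simp] theorem rowProj_apply (i : Fin m) (v : Mat K m n) (c : Fin n) : rowProj K m n i v c = v (i, c) := rfl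

theorem mem_rowSub {i : Fin m} {v : Mat K m n} : v ∈ rowSub K m n i ↔ ∀ p : Fin m × Fin n, p.1 ≠ i → v p = 0 :=
  Iff.rfl

variable (K m n)

/-- **Dimension funding inequality** (memo §1): other rows' forced sections plus the load of row `j⋆` fit
inside `dim Σ`. -/
def DimFunding : Prop :=
  ∀ (E : Submodule K (Mat K m n)) (jstar : Fin m),
    (∑ j : {j : Fin m // j ≠ jstar}, finrank K ↥(E ⊓ rowSub K m n j)) +
        finrank K ↥(E.map (rowProj K m n jstar)) ≤ finrank K ↥E

/-- Dot product of a functional with an input. -/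
def dot (v X : Mat K m n) : K := ∑ p, v p * X p

/-- Row dot product. -/
def rdot (w x : Fin n → K) : K := ∑ c, w c * x c

/-- Solution set of the (consistent) affine system "every functional of `Σ` takes on `X` the value it takes
on the particular solution `X₀`". -/
def Sol (E : Submodule K (Mat K m n)) (X₀ : Mat K m n) : Set (Mat K m n) :=
  {X | ∀ v ∈ E, dot K m n v X = dot K m n v X₀}

/-- **Elimination / projection statement** (memo §3 G1): the row-`j` projection of the solution set is cut
out by the forced sections `Σ ⊓ V_j` alone. -/
def ElimProj : Prop :=
  ∀ (E : Submodule K (Mat K m n)) (X₀ : Mat K m n) (j : Fin m),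
    rowProj K m n j '' Sol K m n E X₀ =
      {x | ∀ v ∈ E ⊓ rowSub K m n j,
        rdot K n (rowProj K m n j v) x = rdot K n (rowProj K m n j v) (rowProj K m n j X₀)}


/-! ### Proof of `DimFunding` -/

section Proof

variable {K m n}

theorem coe_mem_rowSub_apply {j : Fin m} (w : ↥(rowSub K m n j)) (p : Fin m × Fin n) (hp : p.1 ≠ j) :
    (w : Mat K m n) p = 0 := w.2 p hp

/-- The dimension funding inequality holds (over any field). -/
theorem dimFunding : DimFunding K m n := by
  intro E jstar
  classical
  -- the projection to row `jstar`, restricted to `E`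
  let φ : Mat K m n →ₗ[K] (Fin n → K) := rowProj K m n jstar
  let f : ↥E →ₗ[K] (Fin n → K) := φ.comp E.subtype
  have hrange : LinearMap.range f = E.map φ := by
    rw [LinearMap.range_comp, Submodule.range_subtype]
  have hrn : finrank K ↥(LinearMap.range f) + finrank K ↥(LinearMap.ker f) = finrank K ↥E :=
    LinearMap.finrank_range_add_finrank_ker f
  -- the other rows' forced sections, as a product space, map injectively into `ker f`
  let ι := {j : Fin m // j ≠ jstar}
  let N : ι → Submodule K (Mat K m n) := fun j => E ⊓ rowSub K m n (j : Fin m)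
  have hNE : ∀ j : ι, N j ≤ E := fun j => inf_le_left
  have hNrow : ∀ (j : ι) (w : ↥(N j)) (p : Fin m × Fin n), p.1 ≠ (j : Fin m) → (w : Mat K m n) p = 0 :=
    fun j w p hp => (Submodule.mem_inf.mp w.2).2 p hp
  let g : (∀ j : ι, ↥(N j)) →ₗ[K] ↥E :=
    ∑ j : ι, (Submodule.inclusion (hNE j)).comp (LinearMap.proj j)
  have hg_coe : ∀ w : (∀ j : ι, ↥(N j)), ((g w : ↥E) : Mat K m n) = ∑ j : ι, ((w j : ↥(N j)) : Mat K m n) := by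
    intro w
    have h1 : g w = ∑ j : ι, Submodule.inclusion (hNE j) (w j) := by
      simp only [g, LinearMap.coe_sum, Finset.sum_apply, LinearMap.comp_apply, LinearMap.proj_apply]
    rw [h1, Submodule.coe_sum]
    rfl
  have hker : ∀ w : (∀ j : ι, ↥(N j)), f (g w) = 0 := by
    intro w
    funext c
    show φ ((g w : ↥E) : Mat K m n) c = 0
    rw [hg_coe w]
    simp only [φ, rowProj_apply, Finset.sum_apply]
    refine Finset.sum_eq_zero fun j _ => ?_
    exact hNrow j (w j) (jstar, c) (fun h => j.2 h.symm)
  have hinj : Function.Injective g := by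
    rw [injective_iff_map_eq_zero]
    intro w hw
    have hsum : ∑ j : ι, ((w j : ↥(N j)) : Mat K m n) = 0 := by
      rw [← hg_coe w, hw]; rfl
    funext j
    apply Subtype.ext
    funext p
    show ((w j : ↥(N j)) : Mat K m n) p = (0 : Mat K m n) p
    rw [Pi.zero_apply]
    by_cases hp : p.1 = (j : Fin m)
    · have h := congrFun hsum p
      rw [Finset.sum_apply, Pi.zero_apply, Finset.sum_eq_single j] at h
      · exact h
      · intro j' _ hj'
        refine hNrow j' (w j') p ?_
        intro h'
        apply hj'
        exact Subtype.ext (h'.symm.trans hp)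
      · intro h'; exact absurd (Finset.mem_univ j) h'
    · exact hNrow j (w j) p hp
  let g' : (∀ j : ι, ↥(N j)) →ₗ[K] ↥(LinearMap.ker f) :=
    LinearMap.codRestrict (LinearMap.ker f) g (fun w => LinearMap.mem_ker.mpr (hker w))
  have hinj' : Function.Injective g' := by
    intro w w' h
    apply hinj
    have := congrArg Subtype.val h
    simpa [g'] using this
  have h1 : finrank K (∀ j : ι, ↥(N j)) ≤ finrank K ↥(LinearMap.ker f) :=
    LinearMap.finrank_le_finrank_of_injective hinj'
  have h2 : finrank K (∀ j : ι, ↥(N j)) = ∑ j : ι, finrank K ↥(N j) :=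
    Module.finrank_pi_fintype K
  have h3 : finrank K ↥(E.map φ) = finrank K ↥(LinearMap.range f) := by rw [hrange]
  calc (∑ j : ι, finrank K ↥(E ⊓ rowSub K m n (j : Fin m))) + finrank K ↥(E.map (rowProj K m n jstar))
      = finrank K (∀ j : ι, ↥(N j)) + finrank K ↥(LinearMap.range f) := by rw [h2, ← h3]
    _ ≤ finrank K ↥(LinearMap.ker f) + finrank K ↥(LinearMap.range f) := Nat.add_le_add_right h1 _
    _ = finrank K ↥E := by rw [add_comm]; exact hrn

end Proof

end Summit.PneNP.PneNP.Cruxes.StrongComposition.P4g25
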